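import Literature.NumberTheory.EllipticCurves.PAdicLFunctionMuInvariantCertificateProofs
import Summits.BirchSwinnertonDyer.BirchSwinnertonDyer.Theorems.PrintX10bAnalyticMuZeroX10bStubUnitMeasureOfNonconstancy
import HarnessLib

/-!
# LINE C `teichSpan-x9` (crux 19630 `SmallImageMuTransfer.AnalyticMuZeroX9`), stub 2 — part 1/3:
# the Hecke relation `T_p` summed over Teichmüller orbits (the orbit-sum recursion)

Cell `bsd-f3-mu`, seat `p1` (gen 5), `--supports stmt-BirchSwinnertonDyer-19630` (helper).  Theorems only (no
definition, no named fact, no `sorry`).  Part 1 of the proof of the registered stub 2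
`stub_teichOrbitNonConstantAt_of_teichSpanGenAll` of LINE C (skeleton `teichSpan_x9.lean` 7a5ad0a1c1f02cfe, -imc g9;
mathematics -an g5, MEMO-an §14.11), split in three files by the 400-line rule; all in the skeleton's namespace
`Summit.BirchSwinnertonDyer.BirchSwinnertonDyer.Cruxes.AnalyticMuZeroX9.TeichSpan`:
(1/3) this file, (2/3) `…TeichSpanPackets.lean`, (3/3) `…StubTeichOrbitNonConstantAtOfTeichSpanGenAll.lean`.

Contents (for a rational newform `f ∈ S₂(Γ₀(N))`, `p ∤ N`, `a_p(f) = ap ∈ ℤ`; `[r]⁺ = ratPlusSymbol f r`,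
`S_f(p,n,a) = Rank1Residual.teichOrbitSum f p n a = Σ_{t^{p−1}=1} [ta/pⁿ]⁺`):
* §A ultrametric bookkeeping in `ℚ_p` (`‖·‖ < 1` is «`≡ 0 (mod p)`»; the basic lemmas are the tree's
  `padic_norm_add_lt_one` / `CollapseThree.norm_sub_lt_one` / `norm_sum_lt_one`), `norm_div_two_lt_one_of_dvd`;
* §B `intCast_mul_finsum_orbit` — MTT (4.2) `a_p[r]⁺ = Σ_j[(r+j)/p]⁺ + [pr]⁺` (tree `intCast_mul_ratPlusSymbol`) summed
  over the Teichmüller coset of `a ∈ ℤ/p^{n+1}`: `a_p·T_{n+1}(a) = Σ_{b ↦ a} T_{n+2}(b) + T_n(ā)` (the `p` lifts `b` of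
  `a`; reindexing the fibre by the unit `η̄`, `filter_castHom_eq_image`); in `teichOrbitSum` currency
  `intCast_mul_teichOrbitSum_succ` (levels `≥ 2`) and `intCast_mul_teichOrbitSum_one` (level 1, lower term
  `(p−1)[0]⁺`); `teichOrbitSum_one_eq`: `S_f(p,1,a) = (a_p − 2)[0]⁺` (the level-1 coset is `(ℤ/p)ˣ`);
  `norm_teichOrbitSum_le_one` (integrality of the orbit sums from that of the symbols).
HONEST FRAMING: nothing about any curve is asserted; beyond-print theorem: no (MTT folklore made kernel).
References: [MazurTateTeitelbaum1986Invent] §I.4 (4.2), §I.10 (10.1)–(10.2); [Washington1997] §5.1.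
-/

-- the summit namespace repeats `BirchSwinnertonDyer` by design (summit = problem); linter moot
set_option linter.dupNamespace false
set_option autoImplicit false

noncomputable section

open scoped Classical MatrixGroups ModularForm
open CongruenceSubgroup
open Literature.NumberTheory.EllipticCurves.Rank1Residual

namespace Summit.BirchSwinnertonDyer.BirchSwinnertonDyer.Cruxes.AnalyticMuZeroX9.TeichSpan

open Matrix Matrix.SpecialLinearGroup
  Literature.NumberTheory.EllipticCurves Literature.NumberTheory.EllipticCurves.ModularForms
  Summit.BirchSwinnertonDyer.BirchSwinnertonDyer.Theorems.CollapseThree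

/-! ### §A Ultrametric bookkeeping in `ℚ_p` («`≡ (mod p)`» is `‖·‖ < 1`) -/

section Padic

variable {p : ℕ} [Fact p.Prime]

/-- A finite sum of elements of norm `≤ 1` has norm `≤ 1`. [folklore] -/
theorem norm_sum_le_one {ι : Type*} (s : Finset ι) {g : ι → ℚ_[p]} (h : ∀ i ∈ s, ‖g i‖ ≤ 1) :
    ‖∑ i ∈ s, g i‖ ≤ 1 :=
  IsUltrametricDist.norm_sum_le_of_forall_le_of_nonneg zero_le_one h

/-- `‖p·x‖ < 1` for `‖x‖ ≤ 1`. [folklore] -/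
theorem norm_natCast_mul_lt_one {x : ℚ_[p]} (hx : ‖x‖ ≤ 1) : ‖(p : ℚ_[p]) * x‖ < 1 := by
  rw [mul_comm]; exact padic_norm_mul_lt_one hx Padic.norm_p_lt_one

/-- For an odd prime `p` and `p ∣ m`: the half-integer `m/2` has `p`-adic norm `< 1`. [folklore] -/
theorem norm_div_two_lt_one_of_dvd (hp2 : p ≠ 2) {m : ℤ} (h : (p : ℤ) ∣ m) :
    ‖((((m : ℚ) / 2 : ℚ)) : ℚ_[p])‖ < 1 := by
  have hp : p.Prime := Fact.out
  have h2 : ‖((2 : ℤ) : ℚ_[p])‖ = 1 := by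
    refine le_antisymm (Padic.norm_int_le_one 2) (not_lt.mp fun hlt ↦ ?_)
    rw [Padic.norm_intCast_lt_one_iff] at hlt
    have : (p : ℤ) ∣ 2 := hlt
    have hp2' : p ∣ 2 := by exact_mod_cast this
    exact hp2 ((Nat.prime_dvd_prime_iff_eq hp Nat.prime_two).mp hp2')
  have hcast : ((((m : ℚ) / 2 : ℚ)) : ℚ_[p]) = ((m : ℤ) : ℚ_[p]) / ((2 : ℤ) : ℚ_[p]) := by
    push_cast; ring
  rw [hcast, norm_div, h2, div_one, Padic.norm_intCast_lt_one_iff]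
  exact h

end Padic

/-! ### §B The Hecke relation `T_p` summed over Teichmüller orbits (MTT (4.2) ⟹ the orbit-sum recursion) -/

section Orbit

variable {N : ℕ} [NeZero N] {f : CuspForm (Gamma0 N) 2} {p : ℕ} [Fact p.Prime]

/-- The reduction of a Teichmüller representative modulo `pⁿ` is a unit of `ℤ/pⁿ`. [folklore] -/
theorem isUnit_toZModPow_rootsOfUnity (n : ℕ) (ξ : rootsOfUnity (torsionOrder p) ℤ_[p]) :
    IsUnit (PadicInt.toZModPow n ((ξ : ℤ_[p]ˣ) : ℤ_[p])) :=
  (Units.isUnit (ξ : ℤ_[p]ˣ)).map _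

/-- For odd `p` there are exactly `p − 1` Teichmüller representatives. [cite: Washington1997, §5.1 (Teichmüller character ω)] -/
theorem card_rootsOfUnity_eq (hp2 : p ≠ 2) [Fintype (rootsOfUnity (torsionOrder p) ℤ_[p])] :
    Fintype.card (rootsOfUnity (torsionOrder p) ℤ_[p]) = p - 1 := by
  rw [← Nat.card_eq_fintype_card, card_rootsOfUnity_torsionOrder, torsionOrder_eq, if_neg hp2]

/-- `[b/pⁿ]⁺` only depends on `b mod pⁿ`: for an integer `b`, `[b/pⁿ]⁺_f = [(b mod pⁿ).val/pⁿ]⁺_f`.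
[cite: MazurTateTeitelbaum1986Invent, §I.4 (4.2)] -/
theorem ratPlusSymbol_intCast_div_pow (n : ℕ) (b : ℤ) :
    ratPlusSymbol f ((b : ℚ) / (p : ℚ) ^ n) =
      ratPlusSymbol f ((((b : ZMod (p ^ n)).val : ℚ)) / (p : ℚ) ^ n) := by
  haveI : NeZero (p ^ n) := ⟨pow_ne_zero _ (Fact.out : p.Prime).ne_zero⟩
  have hp0 : (p : ℚ) ^ n ≠ 0 := pow_ne_zero _ (Nat.cast_ne_zero.mpr (Fact.out : p.Prime).ne_zero)
  have hval : (((b : ZMod (p ^ n)).val : ℤ)) = b % (p ^ n : ℕ) := ZMod.val_intCast b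
  have hdecomp : (b : ℚ) / (p : ℚ) ^ n =
      (((b : ZMod (p ^ n)).val : ℚ)) / (p : ℚ) ^ n + ((b / (p ^ n : ℕ) : ℤ) : ℤ) := by
    have h : (b : ℤ) = b % (p ^ n : ℕ) + (p ^ n : ℕ) * (b / (p ^ n : ℕ)) := by
      linarith [Int.emod_add_mul_ediv b (p ^ n : ℕ), mul_comm ((p ^ n : ℕ) : ℤ) (b / (p ^ n : ℕ))]
    have h' : (b : ℚ) = (((b : ZMod (p ^ n)).val : ℤ) : ℚ) + ((p : ℚ) ^ n) * ((b / (p ^ n : ℕ) : ℤ) : ℚ) := by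
      rw [hval]; exact_mod_cast h
    rw [Int.cast_natCast] at h'
    rw [h', add_div, mul_div_cancel_left₀ _ hp0]
  rw [hdecomp, ratPlusSymbol_add_intCast_eq]

/-- `[k/p^m]⁺` only depends on `k mod p^m`: for a natural number `k`, `[(k : ℤ/p^m).val/p^m]⁺_f = [k/p^m]⁺_f`.
[cite: MazurTateTeitelbaum1986Invent, §I.4 (4.2)] -/
theorem ratPlusSymbol_natCast_val_div_pow (m k : ℕ) :
    ratPlusSymbol f ((((k : ZMod (p ^ m)).val : ℚ)) / (p : ℚ) ^ m) =
      ratPlusSymbol f ((k : ℚ) / (p : ℚ) ^ m) := by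
  have h := ratPlusSymbol_intCast_div_pow (f := f) (p := p) m (k : ℤ)
  push_cast at h
  exact h.symm

/-- **`T_p` summed over a Teichmüller orbit** (MTT (4.2) `a_p[r]⁺ = Σ_j[(r+j)/p]⁺ + [pr]⁺` at the `p − 1` cusps
`η̄a/p^{n+1}`): with `T_m(x) = Σ_η [η̄x/p^m]⁺_f`,
`a_p · T_{n+1}(a) = Σ_{b ↦ a} T_{n+2}(b) + T_n(ā)` (`b` over the `p` lifts of `a` to `ℤ/p^{n+2}`, `ā = a mod pⁿ`).
[cite: MazurTateTeitelbaum1986Invent, §I.4 (4.2) and §I.10 (10.2)] -/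
theorem intCast_mul_finsum_orbit (hf : IsNewform0 f) (hpN : ¬ p ∣ N) {ap : ℤ} (hap : cuspCoeff f p = ap)
    (hrat : ∀ r : ℚ, (ratPlusSymbol f r : ℝ) = normalizedPlusSymbol f r) (n : ℕ) (a : ZMod (p ^ (n + 1))) :
    (ap : ℚ) * (∑ᶠ ξ : rootsOfUnity (torsionOrder p) ℤ_[p],
        ratPlusSymbol f ((((PadicInt.toZModPow (n + 1) ((ξ : ℤ_[p]ˣ) : ℤ_[p])) * a).val : ℚ) /
          (p : ℚ) ^ (n + 1))) =
      (∑ b ∈ Finset.univ.filter (fun b : ZMod (p ^ (n + 2)) ↦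
          ZMod.castHom (pow_dvd_pow p (n + 1).le_succ) (ZMod (p ^ (n + 1))) b = a),
        ∑ᶠ ξ : rootsOfUnity (torsionOrder p) ℤ_[p],
          ratPlusSymbol f ((((PadicInt.toZModPow (n + 2) ((ξ : ℤ_[p]ˣ) : ℤ_[p])) * b).val : ℚ) /
            (p : ℚ) ^ (n + 2))) +
      ∑ᶠ ξ : rootsOfUnity (torsionOrder p) ℤ_[p],
        ratPlusSymbol f ((((PadicInt.toZModPow n ((ξ : ℤ_[p]ˣ) : ℤ_[p])) *
          ZMod.castHom (pow_dvd_pow p n.le_succ) (ZMod (p ^ n)) a).val : ℚ) / (p : ℚ) ^ n) := by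
  classical
  have hp : p.Prime := Fact.out
  haveI := neZero_torsionOrder p
  haveI := Fintype.ofFinite (rootsOfUnity (torsionOrder p) ℤ_[p])
  haveI : NeZero (p ^ n) := ⟨pow_ne_zero _ hp.ne_zero⟩
  haveI : NeZero (p ^ (n + 1)) := ⟨pow_ne_zero _ hp.ne_zero⟩
  haveI : NeZero (p ^ (n + 2)) := ⟨pow_ne_zero _ hp.ne_zero⟩
  have hpQ : (p : ℚ) ≠ 0 := Nat.cast_ne_zero.mpr hp.ne_zero
  simp only [finsum_eq_sum_of_fintype]
  rw [Finset.mul_sum, Finset.sum_comm, ← Finset.sum_add_distrib]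
  refine Finset.sum_congr rfl fun ξ _ ↦ ?_
  -- abbreviations
  set η₂ := PadicInt.toZModPow (n + 2) ((ξ : ℤ_[p]ˣ) : ℤ_[p]) with hη₂
  set η₁ := PadicInt.toZModPow (n + 1) ((ξ : ℤ_[p]ˣ) : ℤ_[p]) with hη₁
  set η₀ := PadicInt.toZModPow n ((ξ : ℤ_[p]ˣ) : ℤ_[p]) with hη₀
  set v : ℕ := (η₁ * a).val with hv
  -- the Hecke relation at `r = v/p^{n+1}`
  have hH := intCast_mul_ratPlusSymbol p hf hp hpN hap hrat ((v : ℚ) / (p : ℚ) ^ (n + 1))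
  -- the term `[p r]⁺ = [ā-term]`
  have hlast : ratPlusSymbol f ((p : ℚ) * ((v : ℚ) / (p : ℚ) ^ (n + 1))) =
      ratPlusSymbol f ((((η₀ * ZMod.castHom (pow_dvd_pow p n.le_succ) (ZMod (p ^ n)) a).val : ℚ)) /
        (p : ℚ) ^ n) := by
    have e1 : (p : ℚ) * ((v : ℚ) / (p : ℚ) ^ (n + 1)) = (v : ℚ) / (p : ℚ) ^ n := by
      rw [pow_succ]; field_simp
    have hc : ZMod.castHom (pow_dvd_pow p n.le_succ) (ZMod (p ^ n)) η₁ = η₀ := by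
      rw [hη₁, hη₀, ZMod.castHom_apply]; exact PadicInt.cast_toZModPow _ _ n.le_succ _
    have h2 := ratPlusSymbol_val_div_pow_eq_castHom f n (η₁ * a)
    rw [map_mul, hc] at h2
    rw [e1, hv]
    exact h2
  -- the terms `[(r + j)/p]⁺`, `j < p`, are the `T_{n+2}`-terms over the lifts of `a`
  have hfirst : ∑ j : Fin p, ratPlusSymbol f (((v : ℚ) / (p : ℚ) ^ (n + 1) + j) / p) =
      ∑ b ∈ Finset.univ.filter (fun b : ZMod (p ^ (n + 2)) ↦
          ZMod.castHom (pow_dvd_pow p (n + 1).le_succ) (ZMod (p ^ (n + 1))) b = a),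
        ratPlusSymbol f ((((η₂ * b).val : ℚ)) / (p : ℚ) ^ (n + 2)) := by
    -- reindex the fibre of `a` by `b ↦ η₂ b`, landing in the fibre of `η₁ a`
    have hη₂u : IsUnit η₂ := isUnit_toZModPow_rootsOfUnity (n + 2) ξ
    have hcast : ZMod.castHom (pow_dvd_pow p (n + 1).le_succ) (ZMod (p ^ (n + 1))) η₂ = η₁ := by
      rw [hη₂, hη₁, ZMod.castHom_apply]; exact PadicInt.cast_toZModPow _ _ (n + 1).le_succ _
    rw [Finset.sum_nbij' (s := Finset.univ.filter (fun b : ZMod (p ^ (n + 2)) ↦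
          ZMod.castHom (pow_dvd_pow p (n + 1).le_succ) (ZMod (p ^ (n + 1))) b = a))
        (t := Finset.univ.filter (fun c : ZMod (p ^ (n + 2)) ↦
          ZMod.castHom (pow_dvd_pow p (n + 1).le_succ) (ZMod (p ^ (n + 1))) c = η₁ * a))
        (i := fun b ↦ η₂ * b) (j := fun c ↦ hη₂u.unit⁻¹ * c)
        (f := fun b ↦ ratPlusSymbol f ((((η₂ * b).val : ℚ)) / (p : ℚ) ^ (n + 2)))
        (g := fun c ↦ ratPlusSymbol f (((c.val : ℚ)) / (p : ℚ) ^ (n + 2)))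
        (by
          intro b hb
          simp only [Finset.mem_filter, Finset.mem_univ, true_and] at hb ⊢
          rw [map_mul, hcast, hb])
        (by
          intro c hc
          simp only [Finset.mem_filter, Finset.mem_univ, true_and] at hc ⊢
          have h1 : ZMod.castHom (pow_dvd_pow p (n + 1).le_succ) (ZMod (p ^ (n + 1)))
              ((hη₂u.unit⁻¹ : (ZMod (p ^ (n + 2)))ˣ) : ZMod (p ^ (n + 2))) * η₁ = 1 := by
            rw [← hcast, ← map_mul, Units.inv_mul_of_eq hη₂u.unit_spec, map_one]
          rw [map_mul, hc, ← mul_assoc, h1, one_mul])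
        (by intro b _; simp [← mul_assoc, Units.inv_mul_of_eq hη₂u.unit_spec])
        (by intro c _; simp [← mul_assoc, Units.mul_inv_of_eq hη₂u.unit_spec])
        (by intro b _; rfl)]
    -- the fibre of `η₁ a` is `{(η₁ a).val + p^{n+1} j : j < p}`
    rw [filter_castHom_eq_image (n + 1) (η₁ * a), Finset.sum_image]
    · refine Finset.sum_congr rfl fun j _ ↦ ?_
      rw [ratPlusSymbol_natCast_val_div_pow (f := f) (p := p) (n + 2)]
      congr 1
      rw [← hv]; push_cast; field_simp; ring
    · -- injectivity of `j ↦ (η₁ a).val + p^{n+1} j` into `ℤ/p^{n+2}`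
      intro j _ j' _ hjj'
      have hlt : ∀ i : Fin p, v + p ^ (n + 1) * (i : ℕ) < p ^ (n + 2) := by
        intro i
        have h1 : v < p ^ (n + 1) := ZMod.val_lt _
        have h2 : (i : ℕ) ≤ p - 1 := Nat.le_sub_one_of_lt i.isLt
        have h3 : p ^ (n + 1) + p ^ (n + 1) * (p - 1) = p ^ (n + 2) := by
          have h4 : p ^ (n + 1) * (p - 1) + p ^ (n + 1) * 1 = p ^ (n + 1) * p := by
            rw [← Nat.mul_add, Nat.sub_add_cancel hp.one_le]
          rw [pow_succ p (n + 1)]; omega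
        calc v + p ^ (n + 1) * (i : ℕ) < p ^ (n + 1) + p ^ (n + 1) * (p - 1) := by
              have := Nat.mul_le_mul_left (p ^ (n + 1)) h2; omega
          _ = p ^ (n + 2) := h3
      have h := congr_arg ZMod.val hjj'
      rw [← hv, ZMod.val_natCast_of_lt (hlt j), ZMod.val_natCast_of_lt (hlt j')] at h
      have hp0 : 0 < p ^ (n + 1) := pow_pos hp.pos _
      exact Fin.ext (Nat.eq_of_mul_eq_mul_left hp0 (by omega))
  rw [hH, hfirst, hlast]

/-- **The orbit-sum recursion at levels `≥ 2`**: `a_p · S_f(p, n+1, a) = Σ_{b ↦ a} S_f(p, n+2, b) + S_f(p, n, ā)`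
for `n ≥ 1` (MTT (4.2) summed over the Teichmüller coset of `a`).
[cite: MazurTateTeitelbaum1986Invent, §I.4 (4.2) and §I.10 (10.2)] -/
theorem intCast_mul_teichOrbitSum_succ (hf : IsNewform0 f) (hpN : ¬ p ∣ N) {ap : ℤ}
    (hap : cuspCoeff f p = ap) (hrat : ∀ r : ℚ, (ratPlusSymbol f r : ℝ) = normalizedPlusSymbol f r)
    (hp2 : p ≠ 2) {n : ℕ} (hn : 1 ≤ n) (a : ZMod (p ^ (n + 1))) :
    (ap : ℚ) * teichOrbitSum f p (n + 1) a =
      (∑ b ∈ Finset.univ.filter (fun b : ZMod (p ^ (n + 2)) ↦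
          ZMod.castHom (pow_dvd_pow p (n + 1).le_succ) (ZMod (p ^ (n + 1))) b = a),
        teichOrbitSum f p (n + 2) b) +
      teichOrbitSum f p n (ZMod.castHom (pow_dvd_pow p n.le_succ) (ZMod (p ^ n)) a) := by
  rw [teichOrbitSum_eq_finsum f hp2 (by omega) a, teichOrbitSum_eq_finsum f hp2 hn,
    intCast_mul_finsum_orbit hf hpN hap hrat n a]
  congr 1
  refine Finset.sum_congr rfl fun b _ ↦ ?_
  rw [teichOrbitSum_eq_finsum f hp2 (by omega)]

/-- **The orbit-sum recursion at level `1`**: `a_p · S_f(p, 1, a) = Σ_{b ↦ a} S_f(p, 2, b) + (p − 1)·[0]⁺_f` (at level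
`0` every one of the `p − 1` Teichmüller terms is `[0]⁺`). [cite: MazurTateTeitelbaum1986Invent, §I.4 (4.2) and §I.10 (10.2)] -/
theorem intCast_mul_teichOrbitSum_one (hf : IsNewform0 f) (hpN : ¬ p ∣ N) {ap : ℤ}
    (hap : cuspCoeff f p = ap) (hrat : ∀ r : ℚ, (ratPlusSymbol f r : ℝ) = normalizedPlusSymbol f r)
    (hp2 : p ≠ 2) (a : ZMod (p ^ (0 + 1))) :
    (ap : ℚ) * teichOrbitSum f p (0 + 1) a =
      (∑ b ∈ Finset.univ.filter (fun b : ZMod (p ^ (0 + 2)) ↦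
          ZMod.castHom (pow_dvd_pow p (0 + 1).le_succ) (ZMod (p ^ (0 + 1))) b = a),
        teichOrbitSum f p (0 + 2) b) + ((p - 1 : ℕ) : ℚ) * ratPlusSymbol f 0 := by
  classical
  have hp : p.Prime := Fact.out
  haveI := neZero_torsionOrder p
  haveI := Fintype.ofFinite (rootsOfUnity (torsionOrder p) ℤ_[p])
  haveI : NeZero (p ^ 0) := ⟨pow_ne_zero _ hp.ne_zero⟩
  rw [teichOrbitSum_eq_finsum f hp2 le_rfl a, intCast_mul_finsum_orbit hf hpN hap hrat 0 a]
  congr 1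
  · refine Finset.sum_congr rfl fun b _ ↦ ?_
    rw [teichOrbitSum_eq_finsum f hp2 (by omega)]
  · rw [finsum_eq_sum_of_fintype]
    have hterm : ∀ ξ : rootsOfUnity (torsionOrder p) ℤ_[p],
        ratPlusSymbol f ((((PadicInt.toZModPow 0 ((ξ : ℤ_[p]ˣ) : ℤ_[p])) *
          ZMod.castHom (pow_dvd_pow p (0 : ℕ).le_succ) (ZMod (p ^ 0)) a).val : ℚ) / (p : ℚ) ^ 0) =
          ratPlusSymbol f 0 := by
      intro ξ
      have hv : ((PadicInt.toZModPow 0 ((ξ : ℤ_[p]ˣ) : ℤ_[p])) *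
          ZMod.castHom (pow_dvd_pow p (0 : ℕ).le_succ) (ZMod (p ^ 0)) a).val = 0 := by
        have h := (ZMod.val_lt ((PadicInt.toZModPow 0 ((ξ : ℤ_[p]ˣ) : ℤ_[p])) *
          ZMod.castHom (pow_dvd_pow p (0 : ℕ).le_succ) (ZMod (p ^ 0)) a)).trans_eq (pow_zero p)
        omega
      rw [hv]; simp
    simp only [hterm, Finset.sum_const, Finset.card_univ, card_rootsOfUnity_eq hp2, nsmul_eq_mul]

/-- At level `1` the Teichmüller coset of a unit is all of `(ℤ/p)ˣ`, so by MTT (4.2) at `r = 0`: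
`S_f(p, 1, a) = Σ_{0<j<p} [j/p]⁺_f = (a_p − 2)·[0]⁺_f`. [cite: MazurTateTeitelbaum1986Invent, §I.4 (4.2) and §I.10 (10.1)] -/
theorem teichOrbitSum_one_eq (hf : IsNewform0 f) (hpN : ¬ p ∣ N) {ap : ℤ}
    (hap : cuspCoeff f p = ap) (hrat : ∀ r : ℚ, (ratPlusSymbol f r : ℝ) = normalizedPlusSymbol f r)
    (hp2 : p ≠ 2) (a : (ZMod (p ^ (0 + 1)))ˣ) :
    teichOrbitSum f p (0 + 1) (a : ZMod (p ^ (0 + 1))) = ((ap : ℚ) - 2) * ratPlusSymbol f 0 := by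
  classical
  have hp : p.Prime := Fact.out
  haveI := neZero_torsionOrder p
  haveI := Fintype.ofFinite (rootsOfUnity (torsionOrder p) ℤ_[p])
  haveI : NeZero (p ^ 0) := ⟨pow_ne_zero _ hp.ne_zero⟩
  haveI : NeZero (p ^ (0 + 1)) := ⟨pow_ne_zero _ hp.ne_zero⟩
  have hp1 : p ^ (0 + 1) = p := by rw [zero_add, pow_one]
  -- (i) the Hecke relation at `r = 0`: `Σ_{j<p} [j/p]⁺ = (a_p − 1)[0]⁺`
  have hH := intCast_mul_ratPlusSymbol p hf hp hpN hap hrat 0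
  simp only [mul_zero, zero_add] at hH
  -- (ii) `Σ_{t mod p} [t/p]⁺ = Σ_{j<p} [j/p]⁺` via the fibre of `0 ∈ ℤ/p⁰`
  have hfib : Finset.univ.filter (fun b : ZMod (p ^ (0 + 1)) ↦
      ZMod.castHom (pow_dvd_pow p (0 : ℕ).le_succ) (ZMod (p ^ 0)) b = 0) = Finset.univ := by
    refine Finset.eq_univ_of_forall fun b ↦ ?_
    simp only [Finset.mem_filter, Finset.mem_univ, true_and]
    have hx := (ZMod.val_lt (ZMod.castHom (pow_dvd_pow p (0 : ℕ).le_succ) (ZMod (p ^ 0)) b)).trans_eq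
      (pow_zero p)
    have hy := (ZMod.val_lt (0 : ZMod (p ^ 0))).trans_eq (pow_zero p)
    exact ZMod.val_injective _ (by omega)
  have hlt : ∀ j : Fin p, (0 : ZMod (p ^ 0)).val + p ^ 0 * (j : ℕ) < p ^ (0 + 1) := by
    intro j; rw [ZMod.val_zero, pow_zero, one_mul, zero_add, hp1]; exact j.isLt
  have hall : ∑ t : ZMod (p ^ (0 + 1)), ratPlusSymbol f ((t.val : ℚ) / (p : ℚ) ^ (0 + 1)) =
      ∑ j : Fin p, ratPlusSymbol f ((j : ℚ) / p) := by
    rw [← hfib, filter_castHom_eq_image 0 (0 : ZMod (p ^ 0)), Finset.sum_image]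
    · refine Finset.sum_congr rfl fun j _ ↦ ?_
      rw [ZMod.val_natCast_of_lt (hlt j), ZMod.val_zero, pow_zero, one_mul, zero_add, zero_add, pow_one]
    · intro j _ j' _ hjj'
      have h := congr_arg ZMod.val hjj'
      rw [ZMod.val_natCast_of_lt (hlt j), ZMod.val_natCast_of_lt (hlt j')] at h
      simp only [ZMod.val_zero, pow_zero, one_mul, zero_add] at h
      exact Fin.ext h
  -- (iii) split off `t = 0`
  have hsplit : ∑ t : ZMod (p ^ (0 + 1)), ratPlusSymbol f ((t.val : ℚ) / (p : ℚ) ^ (0 + 1)) =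
      ratPlusSymbol f 0 + ∑ t ∈ (Finset.univ : Finset (ZMod (p ^ (0 + 1)))).erase 0,
        ratPlusSymbol f ((t.val : ℚ) / (p : ℚ) ^ (0 + 1)) := by
    rw [← Finset.add_sum_erase _ _ (Finset.mem_univ (0 : ZMod (p ^ (0 + 1))))]
    simp
  -- (iv) the Teichmüller set at level 1 is `{t ≠ 0}`
  have hF : Finset.univ.filter (fun t : ZMod (p ^ (0 + 1)) ↦ t ^ (p - 1) = 1) =
      (Finset.univ : Finset (ZMod (p ^ (0 + 1)))).erase 0 := by
    apply Finset.eq_of_subset_of_card_le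
    · intro t ht
      rw [Finset.mem_filter] at ht
      rw [Finset.mem_erase]
      refine ⟨?_, Finset.mem_univ _⟩
      rintro rfl
      have hp1' : p - 1 ≠ 0 := by have := hp.two_le; omega
      rw [zero_pow hp1'] at ht
      haveI : Nontrivial (ZMod (p ^ (0 + 1))) := by
        rw [hp1]; haveI := Fact.mk hp; infer_instance
      exact zero_ne_one ht.2
    · rw [Finset.card_erase_of_mem (Finset.mem_univ _), Finset.card_univ, ZMod.card,
        ← image_toZModPow_rootsOfUnity_eq_filter p hp2 le_rfl,
        Finset.card_image_of_injective _ (toZModPow_rootsOfUnity_injective_of_le p hp2 le_rfl),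
        Finset.card_univ, card_rootsOfUnity_eq hp2, zero_add, pow_one]
  -- (v) multiplying by the unit `a` permutes `{t ≠ 0}`
  have hperm : ∑ t ∈ (Finset.univ : Finset (ZMod (p ^ (0 + 1)))).erase 0,
      ratPlusSymbol f (((t * (a : ZMod (p ^ (0 + 1)))).val : ℚ) / (p : ℚ) ^ (0 + 1)) =
      ∑ t ∈ (Finset.univ : Finset (ZMod (p ^ (0 + 1)))).erase 0,
        ratPlusSymbol f ((t.val : ℚ) / (p : ℚ) ^ (0 + 1)) := by
    refine Finset.sum_nbij' (fun t ↦ t * (a : ZMod (p ^ (0 + 1)))) (fun t ↦ t * ((a⁻¹ : (ZMod (p ^ (0 + 1)))ˣ) :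
      ZMod (p ^ (0 + 1)))) ?_ ?_ ?_ ?_ ?_
    · intro t ht
      simp only [Finset.mem_erase, ne_eq, Finset.mem_univ, and_true] at ht ⊢
      rwa [Units.mul_left_eq_zero]
    · intro t ht
      simp only [Finset.mem_erase, ne_eq, Finset.mem_univ, and_true] at ht ⊢
      rwa [Units.mul_left_eq_zero]
    · intro t _; simp [mul_assoc]
    · intro t _; simp [mul_assoc]
    · intro t _; rfl
  rw [teichOrbitSum_def, hF, hperm]
  have key : ratPlusSymbol f 0 + ∑ t ∈ (Finset.univ : Finset (ZMod (p ^ (0 + 1)))).erase 0,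
      ratPlusSymbol f ((t.val : ℚ) / (p : ℚ) ^ (0 + 1)) = ((ap : ℚ) - 1) * ratPlusSymbol f 0 := by
    rw [← hsplit, hall]; linear_combination -hH
  linear_combination key

omit [NeZero N] in
/-- The orbit sums are `p`-integral when the symbols at `p`-power cusps are. [folklore] -/
theorem norm_teichOrbitSum_le_one
    (hint : ∀ (k n : ℕ), ‖((ratPlusSymbol f ((k : ℚ) / (p : ℚ) ^ n) : ℚ) : ℚ_[p])‖ ≤ 1)
    (n : ℕ) (a : ZMod (p ^ n)) : ‖((teichOrbitSum f p n a : ℚ) : ℚ_[p])‖ ≤ 1 := by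
  rw [teichOrbitSum_def]
  push_cast
  exact norm_sum_le_one _ fun t _ ↦ hint _ _

end Orbit

end Summit.BirchSwinnertonDyer.BirchSwinnertonDyer.Cruxes.AnalyticMuZeroX9.TeichSpan

end
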